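/-
Copyright (c) 2026 the pub-hodgecm-mathlib formalisation cell (harness21).  Prover seat hodgecm-mathlib-LH4-p13 (g8), req620 Track A «(D-RAM) FOUR-FRAME» squad
(STAGE-1b, row (2) of the piece `f_{T₊}`, the (β₂) road; dealer∕pen LH4-plan (g13) WORD #102∕#110: (S-2) «LABEL TRANSPORT» owner; statement memo `SIG-beta2S.v1` ca422439 §2 (S-2)
of LH4-p04 (g7): «on GENERIC rows the plane term dominates … the line term `(u−1)h_W N(t)` sits below `ϖ^{m*}`»), 2026-09-04.
-/
import Summits.HodgeConjecture.HodgeConjecture.Theorems.F0P3cDyRamBlockGlueValueSet   -- ★ p860233 (LH4-p04 (g7)): `valueSet_endoGL_sub_one_glued_eq_plane`, `latticeValueSetMod_endoGL_sub_one_glued_eq_plane`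
import HarnessLib

/-!
# Crux `H413`, line LH4 «(D-RAM) FOUR-FRAME» — STAGE-1b, row (2), the (β₂) road, (S-2) part i: «ON A PLANE-DOMINATED GLUED VERTEX THE TYPE-(2) LABEL IS FIBRE-CONSTANT»
# — when the line term `(u − 1)·h·N(x₀ 1)` is `ϖ^m`-small the value set of `Γ − 1` is a function of the PLANE data `(B₂, w₀, γ₂, u, H₂)` alone: ANY two glues agree

Cell `hodgecm-mathlib` (D-0151), FLOOR 0, crux item H413 = `stmt-HodgeConjecture-24833`, route of record `HCCMUnconditional`; squad F0∕P3c∕LH4; lane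
`--supports stmt-HodgeConjecture-24833 --as helper` (count-neutral; pays NO tier-0 row).  THEOREMS ONLY (no `def`, no instance, no notation, no `sorry`, default heartbeats).
DATUM-FREE lattice algebra in ★ p860233's plane letters.
WHY.  (S-2) of `SIG-beta2S.v1` (LH4-p04 (g7)) transports the label along the glue fibre `z ↦ z·z₁`; ★ `…GlueLabelNormBlind` (LH4-p09 (g9)) proved blindness to EXACT norm-one
rescalings (same line norm).  On the GENERIC (plane-dominated) cells more is true and is what (S-2) uses: the line term is below `ϖ^{m*}`, so it can be DROPPED from ★ p860233's value
set — after which no trace of the glue scalar `x₀ 1` remains.  Hence the label is constant on the WHOLE norm-residue fibre `Sol_{2b}(r)` (all classes, not only `E¹`-mates), matching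
F0P3-p01 (g36)'s GLUEFIBRE numerics («labels fibre-constant everywhere») on those cells, and the two literals' labels on a common cell compare through plane data only.
* §1 `setOf_thicken_add_small_eq` — generic ultrametric absorption: a `ϖ^m`-small summand does not change a `ϖ^m`-thickened value set.
* §2 `valueSet_endoGL_sub_one_glued_eq_plane_of_line_small` — ★ p860233's value set with the line term dropped, under `|(ϖ^m)⁻¹·(u₀₀ − 1)·σ(x₀ 1)·h·x₀ 1| ≤ 1`.
* §3 `latticeValueSetMod_glued_eq_of_line_small`, `latticeLabelPlus_glued_iff_of_line_small` — two glued vertices over the same `(B₂, w₀, b)`, both plane-dominated at level `m`,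
  carry the same census value set `latticeValueSetMod σ ϖ m · (Γ − 1)` and the same label `LatticeLabelPlus σ ϖ d m · (Γ − 1)` — NO relation between the two glue scalars needed.
HONEST LABEL.  Count-neutral lattice algebra; nothing printed is asserted; no census law is stated; (β₂) stays a HYPOTHESIS; `HC_CM` is proved only modulo the 7 printed citations
(2 remaining named inputs: hLiu418 = `stmt-HodgeConjecture-24832`, h413 = `stmt-HodgeConjecture-24833`) until rung 0 closes.
## References
* [Jacobowitz1962] R. Jacobowitz, *Hermitian forms over local fields*, Amer. J. Math. 84 (1962): §4 (dual lattices, gluing of modular components, norm residues).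
* [Rogawski1990] J. D. Rogawski, *Automorphic Representations of Unitary Groups in Three Variables*, Ann. of Math. Stud. 123 (1990): §4.9 Prop. 4.9.1 (b) p. 55 (the labelled census of `f_{T₊}`).
* [Kottwitz1986BaseChangeUnits] R. E. Kottwitz, *Base change for unit elements of Hecke algebras*, Compositio Math. 60 (1986): §1 pp. 240–241.
-/

set_option autoImplicit false

noncomputable section
namespace Summit.HodgeConjecture.HodgeConjecture.Cruxes.H413.F0P3cDyRamGlueLabelPlaneDominated

open scoped Valued WithZero Matrix MatrixGroups
open Literature.NumberTheory.Automorphic Literature.NumberTheory.Automorphic.HermitianLattice Literature.NumberTheory.Automorphic.UnitaryLatticeTree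
open Literature.NumberTheory.Rogawski1990
open Summit.HodgeConjecture.HodgeConjecture.Cruxes.H413.F0P3cDyRamBlockGlueValueSet
open Summit.HodgeConjecture.HodgeConjecture.Cruxes.H413.F0P3cDyRamFourFrameCensusDefs (latticeValueSetMod LatticeLabelPlus)

variable {K : Type*} [Field K] [Valued K ℤᵐ⁰]

/-! ## §1 Ultrametric absorption of a small summand in a thickened value set -/

/-- **A `ϖ^m`-SMALL SUMMAND DOES NOT CHANGE A `ϖ^m`-THICKENED VALUE SET**: if `|(ϖ^m)⁻¹·L β a| ≤ 1` for all `β ∈ B`, `|a| ≤ 1`, then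
`{z ∣ ∃ β ∈ B, ∃ a, |a| ≤ 1 ∧ |(ϖ^m)⁻¹(z − (P β a + L β a))| ≤ 1} = {z ∣ ∃ β ∈ B, ∃ a, |a| ≤ 1 ∧ |(ϖ^m)⁻¹(z − P β a)| ≤ 1}`. [cite: Jacobowitz1962, §4] -/
theorem setOf_thicken_add_small_eq (ϖ : K) (m : ℕ) (B : Submodule 𝒪[K] (Fin 2 → K)) (P L : (Fin 2 → K) → K → K)
    (hL : ∀ β ∈ B, ∀ a : K, Valued.v a ≤ 1 → Valued.v ((ϖ ^ m)⁻¹ * L β a) ≤ 1) :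
    {z : K | ∃ β ∈ B, ∃ a : K, Valued.v a ≤ 1 ∧ Valued.v ((ϖ ^ m)⁻¹ * (z - (P β a + L β a))) ≤ 1} =
      {z : K | ∃ β ∈ B, ∃ a : K, Valued.v a ≤ 1 ∧ Valued.v ((ϖ ^ m)⁻¹ * (z - P β a)) ≤ 1} := by
  ext z
  simp only [Set.mem_setOf_eq]
  constructor
  · rintro ⟨β, hβ, a, ha, hz⟩
    refine ⟨β, hβ, a, ha, ?_⟩
    have e : (ϖ ^ m)⁻¹ * (z - P β a) = (ϖ ^ m)⁻¹ * (z - (P β a + L β a)) + (ϖ ^ m)⁻¹ * L β a := by ring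
    rw [e]
    exact (Valuation.map_add _ _ _).trans (max_le hz (hL β hβ a ha))
  · rintro ⟨β, hβ, a, ha, hz⟩
    refine ⟨β, hβ, a, ha, ?_⟩
    have e : (ϖ ^ m)⁻¹ * (z - (P β a + L β a)) = (ϖ ^ m)⁻¹ * (z - P β a) + -((ϖ ^ m)⁻¹ * L β a) := by ring
    rw [e]
    exact (Valuation.map_add _ _ _).trans (max_le hz (by rw [Valuation.map_neg]; exact hL β hβ a ha))

/-- The line term at `|a| ≤ 1` is bounded by the line term at `a = 1`: `|(ϖ^m)⁻¹·c·σ(a t)·h·(a t)| ≤ |(ϖ^m)⁻¹·c·σt·h·t|` (`σ` isometric). [cite: Jacobowitz1962, §4] -/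
theorem v_lineTerm_le (σ : K →+* K) (hvσ : ∀ x, Valued.v (σ x) = Valued.v x) (ϖ : K) (m : ℕ) (c h t : K) {a : K} (ha : Valued.v a ≤ 1) :
    Valued.v ((ϖ ^ m)⁻¹ * (c * (σ (a * t) * h * (a * t)))) ≤ Valued.v ((ϖ ^ m)⁻¹ * (c * (σ t * h * t))) := by
  have e : (ϖ ^ m)⁻¹ * (c * (σ (a * t) * h * (a * t))) = (σ a * a) * ((ϖ ^ m)⁻¹ * (c * (σ t * h * t))) := by rw [map_mul]; ring
  rw [e, map_mul]
  refine mul_le_of_le_one_left' ?_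
  rw [map_mul, hvσ]; exact mul_le_one' ha ha

/-! ## §2 The value set of a plane-dominated glued vertex: the line term dropped -/

/-- **THE VALUE SET OF `Γ − 1` ON A PLANE-DOMINATED GLUED VERTEX.**  In ★ p860233's glue letters (`hpr, hB, hx₀, hx₀1, hprx`), if the line term is `ϖ^m`-small,
`|(ϖ^m)⁻¹·(u₀₀ − 1)·σ(x₀ 1)·h·x₀ 1| ≤ 1`, then the `ϖ^m`-thickened value set of `y ↦ ⟨y, (Γ − 1)y⟩_H` equals the PLANE set
`{z ∣ ∃ β ∈ B₂, ∃ a, |a| ≤ 1 ∧ |(ϖ^m)⁻¹(z − (⟨β′, (γ₂ − u₀₀)β′⟩_{H₂} + (u₀₀ − 1)⟨β′, β′⟩_{H₂}))| ≤ 1}`, `β′ = β + a·w₀` — in which the glue scalar `x₀ 1` no longer occurs.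
[cite: Jacobowitz1962, §4] [cite: Rogawski1990, §4.9 Prop. 4.9.1 (b) p. 55] -/
theorem valueSet_endoGL_sub_one_glued_eq_plane_of_line_small (σ : K →+* K) (hvσ : ∀ x, Valued.v (σ x) = Valued.v x) {ϖ : K} (hϖ : Valued.v ϖ = WithZero.exp (-1 : ℤ))
    (H₂ : Matrix (Fin 2) (Fin 2) K) (h : K)
    {M : Submodule 𝒪[K] (Fin 3 → K)} {b : ℕ} (hpr : ∀ x ∈ M, Valued.v (x 1) * Valued.v ϖ ^ b ≤ 1)
    {B₂ : Submodule 𝒪[K] (Fin 2 → K)} {w₀ : Fin 2 → K} {x₀ : Fin 3 → K}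
    (hB : B₂.map ((Matrix.toLin' (!![1, 0; 0, 0; 0, 1] : Matrix (Fin 3) (Fin 2) K)).restrictScalars 𝒪[K]) =
      M ⊓ LinearMap.ker ((LinearMap.proj (1 : Fin 3) : (Fin 3 → K) →ₗ[K] K).restrictScalars 𝒪[K]))
    (hx₀ : x₀ ∈ M) (hx₀1 : Valued.v (x₀ 1) * Valued.v ϖ ^ b = 1) (hprx : x₀ - Pi.single 1 (x₀ 1) = ![w₀ 0, 0, w₀ 1])
    (γ₂ : GL (Fin 2) K) (u : GL (Fin 1) K) (m : ℕ)
    (hline : Valued.v ((ϖ ^ m)⁻¹ * (((u : Matrix (Fin 1) (Fin 1) K) 0 0 - 1) * (σ (x₀ 1) * h * x₀ 1))) ≤ 1) :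
    {z : K | ∃ y ∈ M, Valued.v ((ϖ ^ m)⁻¹ * (z - pairing σ (!![H₂ 0 0, 0, H₂ 0 1; 0, h, 0; H₂ 1 0, 0, H₂ 1 1] : Matrix (Fin 3) (Fin 3) K) y ((((endoGL (γ₂, u) : GL (Fin 3) K) : Matrix (Fin 3) (Fin 3) K) - 1) *ᵥ y))) ≤ 1} =
      {z : K | ∃ β ∈ B₂, ∃ a : K, Valued.v a ≤ 1 ∧
        Valued.v ((ϖ ^ m)⁻¹ * (z - (pairing σ H₂ (β + a • w₀) ((((γ₂ : Matrix (Fin 2) (Fin 2) K) - (u : Matrix (Fin 1) (Fin 1) K) 0 0 • (1 : Matrix (Fin 2) (Fin 2) K))) *ᵥ (β + a • w₀)) +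
          ((u : Matrix (Fin 1) (Fin 1) K) 0 0 - 1) * pairing σ H₂ (β + a • w₀) (β + a • w₀)))) ≤ 1} := by
  rw [valueSet_endoGL_sub_one_glued_eq_plane σ hϖ H₂ h hpr hB hx₀ hx₀1 hprx γ₂ u m]
  have key := setOf_thicken_add_small_eq ϖ m B₂
    (fun β a => pairing σ H₂ (β + a • w₀) ((((γ₂ : Matrix (Fin 2) (Fin 2) K) - (u : Matrix (Fin 1) (Fin 1) K) 0 0 • (1 : Matrix (Fin 2) (Fin 2) K))) *ᵥ (β + a • w₀)) +
      ((u : Matrix (Fin 1) (Fin 1) K) 0 0 - 1) * pairing σ H₂ (β + a • w₀) (β + a • w₀))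
    (fun _ a => ((u : Matrix (Fin 1) (Fin 1) K) 0 0 - 1) * (σ (a * x₀ 1) * h * (a * x₀ 1)))
    (fun β _ a ha => (v_lineTerm_le σ hvσ ϖ m _ h (x₀ 1) ha).trans hline)
  have e1 : ∀ (β : Fin 2 → K) (a : K) (z : K),
      (ϖ ^ m)⁻¹ * (z - (pairing σ H₂ (β + a • w₀) ((((γ₂ : Matrix (Fin 2) (Fin 2) K) - (u : Matrix (Fin 1) (Fin 1) K) 0 0 • (1 : Matrix (Fin 2) (Fin 2) K))) *ᵥ (β + a • w₀)) +
        ((u : Matrix (Fin 1) (Fin 1) K) 0 0 - 1) * (pairing σ H₂ (β + a • w₀) (β + a • w₀) + σ (a * x₀ 1) * h * (a * x₀ 1)))) =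
      (ϖ ^ m)⁻¹ * (z - ((pairing σ H₂ (β + a • w₀) ((((γ₂ : Matrix (Fin 2) (Fin 2) K) - (u : Matrix (Fin 1) (Fin 1) K) 0 0 • (1 : Matrix (Fin 2) (Fin 2) K))) *ᵥ (β + a • w₀)) +
        ((u : Matrix (Fin 1) (Fin 1) K) 0 0 - 1) * pairing σ H₂ (β + a • w₀) (β + a • w₀)) +
        ((u : Matrix (Fin 1) (Fin 1) K) 0 0 - 1) * (σ (a * x₀ 1) * h * (a * x₀ 1)))) := fun β a z => by ring
  simp only [e1]
  exact key

/-! ## §3 Two plane-dominated glues over the same plane data carry the same census value set and the same label -/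

/-- **(S-2, plane-dominated) THE CENSUS VALUE SET IS FIBRE-CONSTANT.**  At `Φ₃ = block(Φ₂, 1)` (★ p860233 §4): two glued vertices `M, M′` over the same `(B₂, w₀, b)` whose line terms
are both `ϖ^m`-small (`|(ϖ^m)⁻¹(u₀₀ − 1)N(x₀ 1)| ≤ 1`, `|(ϖ^m)⁻¹(u₀₀ − 1)N(x₀′ 1)| ≤ 1`) have the same ★ census DEFS `latticeValueSetMod σ ϖ m · (Γ − 1)` — whatever the two glue
scalars. [cite: Jacobowitz1962, §4] [cite: Rogawski1990, §4.9 Prop. 4.9.1 (b) p. 55] -/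
theorem latticeValueSetMod_glued_eq_of_line_small (σ : K →+* K) (hvσ : ∀ x, Valued.v (σ x) = Valued.v x) {ϖ : K} (hϖ : Valued.v ϖ = WithZero.exp (-1 : ℤ))
    {M M' : Submodule 𝒪[K] (Fin 3 → K)} {b : ℕ} (hpr : ∀ x ∈ M, Valued.v (x 1) * Valued.v ϖ ^ b ≤ 1) (hpr' : ∀ x ∈ M', Valued.v (x 1) * Valued.v ϖ ^ b ≤ 1)
    {B₂ : Submodule 𝒪[K] (Fin 2 → K)} {w₀ : Fin 2 → K} {x₀ x₀' : Fin 3 → K}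
    (hB : B₂.map ((Matrix.toLin' (!![1, 0; 0, 0; 0, 1] : Matrix (Fin 3) (Fin 2) K)).restrictScalars 𝒪[K]) =
      M ⊓ LinearMap.ker ((LinearMap.proj (1 : Fin 3) : (Fin 3 → K) →ₗ[K] K).restrictScalars 𝒪[K]))
    (hB' : B₂.map ((Matrix.toLin' (!![1, 0; 0, 0; 0, 1] : Matrix (Fin 3) (Fin 2) K)).restrictScalars 𝒪[K]) =
      M' ⊓ LinearMap.ker ((LinearMap.proj (1 : Fin 3) : (Fin 3 → K) →ₗ[K] K).restrictScalars 𝒪[K]))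
    (hx₀ : x₀ ∈ M) (hx₀' : x₀' ∈ M') (hx₀1 : Valued.v (x₀ 1) * Valued.v ϖ ^ b = 1) (hx₀'1 : Valued.v (x₀' 1) * Valued.v ϖ ^ b = 1)
    (hprx : x₀ - Pi.single 1 (x₀ 1) = ![w₀ 0, 0, w₀ 1]) (hprx' : x₀' - Pi.single 1 (x₀' 1) = ![w₀ 0, 0, w₀ 1])
    (γ₂ : GL (Fin 2) K) (u : GL (Fin 1) K) (m : ℕ)
    (hline : Valued.v ((ϖ ^ m)⁻¹ * (((u : Matrix (Fin 1) (Fin 1) K) 0 0 - 1) * (σ (x₀ 1) * 1 * x₀ 1))) ≤ 1)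
    (hline' : Valued.v ((ϖ ^ m)⁻¹ * (((u : Matrix (Fin 1) (Fin 1) K) 0 0 - 1) * (σ (x₀' 1) * 1 * x₀' 1))) ≤ 1) :
    latticeValueSetMod σ ϖ m M (((endoGL (γ₂, u) : GL (Fin 3) K) : Matrix (Fin 3) (Fin 3) K) - 1) =
      latticeValueSetMod σ ϖ m M' (((endoGL (γ₂, u) : GL (Fin 3) K) : Matrix (Fin 3) (Fin 3) K) - 1) := by
  rw [latticeValueSetMod_endoGL_sub_one_glued_eq_plane σ hϖ hpr hB hx₀ hx₀1 hprx γ₂ u m,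
    latticeValueSetMod_endoGL_sub_one_glued_eq_plane σ hϖ hpr' hB' hx₀' hx₀'1 hprx' γ₂ u m]
  have key := fun (t : K) (ht : Valued.v ((ϖ ^ m)⁻¹ * (((u : Matrix (Fin 1) (Fin 1) K) 0 0 - 1) * (σ t * 1 * t))) ≤ 1) =>
    setOf_thicken_add_small_eq ϖ m B₂
      (fun β a => pairing σ ((StdForm.antidiagonal 2).over K) (β + a • w₀)
          ((((γ₂ : Matrix (Fin 2) (Fin 2) K) - (u : Matrix (Fin 1) (Fin 1) K) 0 0 • (1 : Matrix (Fin 2) (Fin 2) K))) *ᵥ (β + a • w₀)) +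
        ((u : Matrix (Fin 1) (Fin 1) K) 0 0 - 1) * pairing σ ((StdForm.antidiagonal 2).over K) (β + a • w₀) (β + a • w₀))
      (fun _ a => ((u : Matrix (Fin 1) (Fin 1) K) 0 0 - 1) * (σ (a * t) * 1 * (a * t)))
      (fun β _ a ha => (v_lineTerm_le σ hvσ ϖ m _ 1 t ha).trans ht)
  have k1 := key (x₀ 1) hline
  have k2 := key (x₀' 1) hline'
  have e1 : ∀ (t : K) (β : Fin 2 → K) (a : K) (z : K),
      (ϖ ^ m)⁻¹ * (z - (pairing σ ((StdForm.antidiagonal 2).over K) (β + a • w₀)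
          ((((γ₂ : Matrix (Fin 2) (Fin 2) K) - (u : Matrix (Fin 1) (Fin 1) K) 0 0 • (1 : Matrix (Fin 2) (Fin 2) K))) *ᵥ (β + a • w₀)) +
        ((u : Matrix (Fin 1) (Fin 1) K) 0 0 - 1) * (pairing σ ((StdForm.antidiagonal 2).over K) (β + a • w₀) (β + a • w₀) + σ (a * t) * 1 * (a * t)))) =
      (ϖ ^ m)⁻¹ * (z - ((pairing σ ((StdForm.antidiagonal 2).over K) (β + a • w₀)
          ((((γ₂ : Matrix (Fin 2) (Fin 2) K) - (u : Matrix (Fin 1) (Fin 1) K) 0 0 • (1 : Matrix (Fin 2) (Fin 2) K))) *ᵥ (β + a • w₀)) +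
        ((u : Matrix (Fin 1) (Fin 1) K) 0 0 - 1) * pairing σ ((StdForm.antidiagonal 2).over K) (β + a • w₀) (β + a • w₀)) +
        ((u : Matrix (Fin 1) (Fin 1) K) 0 0 - 1) * (σ (a * t) * 1 * (a * t)))) := fun t β a z => by ring
  simp only [e1]
  rw [k1, k2]

/-- **(S-2, plane-dominated) THE LABEL IS FIBRE-CONSTANT.**  Same hypotheses: the two glued vertices carry the same transvection label `LatticeLabelPlus σ ϖ d m · (Γ − 1)`.
[cite: Rogawski1990, §4.9 Prop. 4.9.1 (b) p. 55] [cite: Jacobowitz1962, §4] -/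
theorem latticeLabelPlus_glued_iff_of_line_small (σ : K →+* K) (hvσ : ∀ x, Valued.v (σ x) = Valued.v x) {ϖ : K} (hϖ : Valued.v ϖ = WithZero.exp (-1 : ℤ))
    {M M' : Submodule 𝒪[K] (Fin 3 → K)} {b : ℕ} (hpr : ∀ x ∈ M, Valued.v (x 1) * Valued.v ϖ ^ b ≤ 1) (hpr' : ∀ x ∈ M', Valued.v (x 1) * Valued.v ϖ ^ b ≤ 1)
    {B₂ : Submodule 𝒪[K] (Fin 2 → K)} {w₀ : Fin 2 → K} {x₀ x₀' : Fin 3 → K}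
    (hB : B₂.map ((Matrix.toLin' (!![1, 0; 0, 0; 0, 1] : Matrix (Fin 3) (Fin 2) K)).restrictScalars 𝒪[K]) =
      M ⊓ LinearMap.ker ((LinearMap.proj (1 : Fin 3) : (Fin 3 → K) →ₗ[K] K).restrictScalars 𝒪[K]))
    (hB' : B₂.map ((Matrix.toLin' (!![1, 0; 0, 0; 0, 1] : Matrix (Fin 3) (Fin 2) K)).restrictScalars 𝒪[K]) =
      M' ⊓ LinearMap.ker ((LinearMap.proj (1 : Fin 3) : (Fin 3 → K) →ₗ[K] K).restrictScalars 𝒪[K]))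
    (hx₀ : x₀ ∈ M) (hx₀' : x₀' ∈ M') (hx₀1 : Valued.v (x₀ 1) * Valued.v ϖ ^ b = 1) (hx₀'1 : Valued.v (x₀' 1) * Valued.v ϖ ^ b = 1)
    (hprx : x₀ - Pi.single 1 (x₀ 1) = ![w₀ 0, 0, w₀ 1]) (hprx' : x₀' - Pi.single 1 (x₀' 1) = ![w₀ 0, 0, w₀ 1])
    (γ₂ : GL (Fin 2) K) (u : GL (Fin 1) K) (d m : ℕ)
    (hline : Valued.v ((ϖ ^ m)⁻¹ * (((u : Matrix (Fin 1) (Fin 1) K) 0 0 - 1) * (σ (x₀ 1) * 1 * x₀ 1))) ≤ 1)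
    (hline' : Valued.v ((ϖ ^ m)⁻¹ * (((u : Matrix (Fin 1) (Fin 1) K) 0 0 - 1) * (σ (x₀' 1) * 1 * x₀' 1))) ≤ 1) :
    LatticeLabelPlus σ ϖ d m M (((endoGL (γ₂, u) : GL (Fin 3) K) : Matrix (Fin 3) (Fin 3) K) - 1) ↔
      LatticeLabelPlus σ ϖ d m M' (((endoGL (γ₂, u) : GL (Fin 3) K) : Matrix (Fin 3) (Fin 3) K) - 1) := by
  unfold Summit.HodgeConjecture.HodgeConjecture.Cruxes.H413.F0P3cDyRamFourFrameCensusDefs.LatticeLabelPlus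
  rw [latticeValueSetMod_glued_eq_of_line_small σ hvσ hϖ hpr hpr' hB hB' hx₀ hx₀' hx₀1 hx₀'1 hprx hprx' γ₂ u m hline hline']

end Summit.HodgeConjecture.HodgeConjecture.Cruxes.H413.F0P3cDyRamGlueLabelPlaneDominated

end
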